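import Literature.AlgebraicGeometry.HodgeTheory.FermatHodgeCharacterTriple
import Literature.AlgebraicGeometry.HodgeTheory.FermatHodgeCharacterPeel
import HarnessLib

/-!
# Three-term configurations annihilated by ALL primitive characters force `9 ∣ n`

Support file X (everything PROVED; no named facts, no definitions) for the structure theorem of
the Hodge characters of the Fermat surface (`AokiShioda1983_thmB2m_standard`).

`triple_allprim_nine_dvd`: if `n` is odd or divisible by `4` and `a, b, c ∈ (ℤ/n)ˣ`,
`s₁, s₂, s₃ ∈ {±1}` satisfy `s₁ χ(a) + s₂ χ(b) + s₃ χ(c) = 0` for EVERY primitive character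
`χ` mod `n` (both parities), then `9 ∣ n` (and then the configuration is the kernel coset of
`(ℤ/n)ˣ → (ℤ/(n/3))ˣ` up to the twists `-u, -v`, which we do not need). This is the "no
three-term relations at `3`-free levels" input of the four-point recursion. Proof: as in
file `Triple` (cube roots of unity, `c = (b/a)⁴` has `c³ = 1` by `U*(n) ⊆ {1, uv}`,
`U**(n) ⊆ {-u, -v}` of file `Peel`, local triviality at `p ≠ 3` by fibre counting — here
without any parity bookkeeping and without exceptional levels).

## References

* [Aoki1983] N. Aoki, On some arithmetic problems related to the Hodge cycles on the Fermat
  varieties, Math. Ann. 266 (1983) 23–54, §§6–8 (text read).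
-/

noncomputable section

open Finset

namespace Literature.AlgebraicGeometry.HodgeTheory

namespace FermatCharacter

/-! ### Local triviality at `p ≠ 3` in the all-primitive setting -/

/-- At level `p^e · n` (`p ≠ 3`), a unit `c` with `c³ = 1` on which every primitive character
is a primitive cube root of unity is `≡ 1 (mod p^e)`. [cite: Aoki1983, Prop. 8.1] -/
theorem unitsMap_eq_one_of_cube_allprim {p e n : ℕ} [NeZero n] (hp : p.Prime) (hp3 : p ≠ 3)
    (he : 1 ≤ e) [NeZero (p ^ e)] (hcop : (p ^ e).Coprime n) (hn : Odd n ∨ 4 ∣ n)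
    (c : (ZMod (p ^ e * n))ˣ) (hc3 : c ^ 3 = 1)
    (hc : ∀ χ : DirichletCharacter ℂ (p ^ e * n), χ.IsPrimitive → χ c ≠ 1) :
    ZMod.unitsMap (dvd_mul_right (p ^ e) n) c = 1 := by
  classical
  haveI : NeZero (p ^ e * n) := ⟨mul_ne_zero (NeZero.ne _) (NeZero.ne n)⟩
  haveI : Fact (Nat.Prime 3) := ⟨Nat.prime_three⟩
  by_contra hne
  set cq := ZMod.unitsMap (dvd_mul_right (p ^ e) n) c with hcq
  set cn := ZMod.unitsMap (dvd_mul_left n (p ^ e)) c with hcn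
  have hcq3 : cq ^ 3 = 1 := by rw [hcq, ← map_pow, hc3, map_one]
  have hcn3 : cn ^ 3 = 1 := by rw [hcn, ← map_pow, hc3, map_one]
  have hord : orderOf cq = 3 := orderOf_eq_prime hcq3 hne
  have h3card : 3 ∣ (p ^ e).totient := by
    rw [← ZMod.card_units_eq_totient, ← hord]; exact orderOf_dvd_card
  have hp2 : p ≠ 2 := by
    rintro rfl
    rw [Nat.totient_prime_pow Nat.prime_two (by omega)] at h3card
    have : 3 ∣ 2 ^ (e - 1) := by simpa using h3card
    have := Nat.Prime.dvd_of_dvd_pow Nat.prime_three this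
    omega
  -- `3 φ(p^(e-1)) < φ(p^e)`
  have hlt : 3 * (p ^ (e - 1)).totient < (p ^ e).totient := by
    have hφe : (p ^ e).totient = p ^ (e - 1) * (p - 1) := Nat.totient_prime_pow hp (by omega)
    rw [hφe] at h3card ⊢
    have h31 : 3 ∣ p - 1 := by
      have hcp : Nat.Coprime 3 (p ^ (e - 1)) :=
        Nat.Coprime.pow_right _ ((Nat.coprime_primes Nat.prime_three hp).mpr (Ne.symm hp3))
      exact hcp.dvd_of_dvd_mul_left h3card
    have hp7 : 7 ≤ p := by
      have h5 := hp.two_le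
      obtain ⟨k, hk⟩ := hp.odd_of_ne_two hp2
      obtain ⟨j, hj⟩ := h31
      omega
    rcases Nat.lt_or_ge e 2 with he2 | he2
    · have he1 : e = 1 := by omega
      subst he1
      simp only [Nat.sub_self, pow_zero, Nat.totient_one, mul_one, one_mul]
      omega
    · have hφ : (p ^ (e - 1)).totient = p ^ (e - 1 - 1) * (p - 1) :=
        Nat.totient_prime_pow hp (by omega)
      rw [hφ]
      have hpow : p ^ (e - 1) = p ^ (e - 1 - 1) * p := by rw [← pow_succ]; congr 1; omega
      rw [hpow]
      have hpos : 0 < p ^ (e - 1 - 1) * (p - 1) := Nat.mul_pos (pow_pos hp.pos _) (by omega)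
      calc 3 * (p ^ (e - 1 - 1) * (p - 1)) < 7 * (p ^ (e - 1 - 1) * (p - 1)) :=
            (Nat.mul_lt_mul_right hpos).mpr (by norm_num)
        _ ≤ p * (p ^ (e - 1 - 1) * (p - 1)) := Nat.mul_le_mul_right _ hp7
        _ = p ^ (e - 1 - 1) * p * (p - 1) := by ring
  -- a primitive `ψ` mod `n` and the target value
  obtain ⟨ψ, hψ⟩ := exists_isPrimitive (n := n) hn
  set ζ : ℂ := ψ (cn : ZMod n) ^ 2 with hζ
  have hψ3 : ψ (cn : ZMod n) ^ 3 = 1 := by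
    rw [← map_pow, ← Units.val_pow_eq_pow_val, hcn3, Units.val_one, map_one]
  have hζ3 : ζ ^ 3 = 1 := by
    rw [hζ, ← pow_mul, show 2 * 3 = 3 * 2 by norm_num, pow_mul, hψ3, one_pow]
  have hζψ : ζ * ψ (cn : ZMod n) = 1 := by rw [hζ, ← pow_succ, hψ3]
  obtain ⟨χq, hqval, hnf⟩ := exists_apply_eq_not_factorsThrough (pow_dvd_pow p (Nat.sub_le e 1))
    cq hord (by norm_num) hζ3 hlt
  have hqprim := isPrimitive_of_not_factorsThrough_primePow hp he χq hnf
  have hprim := prodChar_isPrimitive hcop hqprim hψ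
  have hval : (DirichletCharacter.changeLevel (dvd_mul_right (p ^ e) n) χq *
      DirichletCharacter.changeLevel (dvd_mul_left n (p ^ e)) ψ) c = 1 := by
    rw [prodChar_apply, ← coe_unitsMap, ← coe_unitsMap, ← hcq, ← hcn, hqval, hζψ]
  exact hc _ hprim hval

/-- Local triviality as a divisibility, all-primitive version. [cite: Aoki1983, Prop. 8.1] -/
theorem ordProj_dvd_val_sub_one_allprim {f : ℕ} [NeZero f] (hval : Odd f ∨ 4 ∣ f)
    (c : (ZMod f)ˣ) (hc3 : c ^ 3 = 1)
    (hc : ∀ χ : DirichletCharacter ℂ f, χ.IsPrimitive → χ c ≠ 1)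
    {p : ℕ} (hp : p.Prime) (hpf : p ∣ f) (hp3 : p ≠ 3) :
    p ^ f.factorization p ∣ ((c : ZMod f) - 1).val := by
  classical
  have hf0 : f ≠ 0 := NeZero.ne f
  obtain ⟨e, he⟩ : ∃ e, f.factorization p = e := ⟨_, rfl⟩
  have he1 : 1 ≤ e := he ▸ hp.factorization_pos_of_dvd hf0 hpf
  have hcop0 : Nat.Coprime p (f / p ^ e) := he ▸ Nat.coprime_ordCompl hp hf0
  rw [he]
  obtain ⟨n, hfn⟩ : ∃ n, f = p ^ e * n :=
    ⟨f / p ^ e, by rw [← he]; exact (Nat.ordProj_mul_ordCompl_eq_self f p).symm⟩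
  have hpe0 : p ^ e ≠ 0 := pow_ne_zero e hp.ne_zero
  have hn0 : n ≠ 0 := fun h0 ↦ hf0 (by rw [hfn, h0, mul_zero])
  haveI : NeZero n := ⟨hn0⟩
  haveI : NeZero (p ^ e) := ⟨hpe0⟩
  have hdiv : p ^ e * n / p ^ e = n := Nat.mul_div_cancel_left n (Nat.pos_of_ne_zero hpe0)
  rw [hfn, hdiv] at hcop0
  have hcop : (p ^ e).Coprime n := Nat.Coprime.pow_left e hcop0
  subst hfn
  have hnval : Odd n ∨ 4 ∣ n := by
    by_cases hp2 : p = 2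
    · subst hp2
      left
      have h2n : Nat.Coprime 2 n := Nat.Coprime.coprime_dvd_left (dvd_pow_self 2 (by omega)) hcop
      have : ¬ 2 ∣ n := (Nat.Prime.coprime_iff_not_dvd Nat.prime_two).mp h2n
      exact Nat.odd_iff.mpr (by omega)
    · rcases hval with ho | h4
      · exact Or.inl (Nat.Odd.of_mul_right ho)
      · right
        have hc' : Nat.Coprime (2 ^ 2) (p ^ e) :=
          Nat.Coprime.pow 2 e ((Nat.coprime_primes Nat.prime_two hp).mpr (Ne.symm hp2))
        exact (show Nat.Coprime 4 (p ^ e) by simpa using hc').dvd_of_dvd_mul_left h4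
  have key := unitsMap_eq_one_of_cube_allprim hp hp3 he1 hcop hnval c hc3 hc
  have hcast : ZMod.castHom (dvd_mul_right (p ^ e) n) (ZMod (p ^ e))
      ((c : ZMod (p ^ e * n)) - 1) = 0 := by
    rw [map_sub, ← coe_unitsMap, key, Units.val_one, map_one, sub_self]
  rw [ZMod.castHom_apply, ZMod.cast_eq_val, ZMod.natCast_eq_zero_iff] at hcast
  exact hcast

/-! ### Elements of `U*(n) ∪ U**(n)` square to `1` -/

/-- If `χ(t) = σ = ±1` for every primitive `χ` mod `n`, then `t² = 1`. [cite: Aoki1983, §6] -/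
theorem sq_eq_one_of_forall_isPrimitive {n : ℕ} [NeZero n] (hval : Odd n ∨ 4 ∣ n)
    (t : (ZMod n)ˣ) {σ : ℂ} (hσ : σ = 1 ∨ σ = -1)
    (ht : ∀ χ : DirichletCharacter ℂ n, χ.IsPrimitive → χ t = σ) : (t : ZMod n) ^ 2 = 1 := by
  rcases hσ with rfl | rfl
  · rcases coe_eq_of_forall_isPrimitive_eq_one hval t ht with h | ⟨h4, h3, h9, h⟩
    · rw [h, one_pow]
    · rw [h, mul_pow, uElt_sq h4, vElt_sq h3 h9, one_mul]
  · rcases coe_eq_of_forall_isPrimitive_eq_neg_one hval t ht with ⟨h4, h⟩ | ⟨h3, h9, h⟩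
    · rw [h]
      have hhalf2 : (2 : ZMod n) * ((n / 2 : ℕ) : ZMod n) = 0 := by
        rw [show (2 : ZMod n) = ((2 : ℕ) : ZMod n) by norm_cast, ← Nat.cast_mul,
          ZMod.natCast_eq_zero_iff, Nat.mul_div_cancel' (dvd_trans (by norm_num) h4)]
      have hu := uElt_sq (N := n) h4
      linear_combination hu + 2 * hhalf2
    · rw [h]
      have hv := vElt_sq (N := n) h3 h9
      linear_combination hv

/-! ### The theorem -/

/-- **Three-term configurations annihilated by all primitive characters force `9 ∣ n`.**
If `s₁ χ(a) + s₂ χ(b) + s₃ χ(c) = 0` (`sᵢ = ±1`) for every primitive character `χ` mod `n`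
(`n` odd or `4 ∣ n`), then `9 ∣ n`. [cite: Aoki1983, Prop. 8.1] -/
theorem nine_dvd_of_triple_allprim {n : ℕ} [NeZero n] (hval : Odd n ∨ 4 ∣ n)
    (a b c : (ZMod n)ˣ) {s₁ s₂ s₃ : ℂ} (hs₁ : s₁ = 1 ∨ s₁ = -1) (hs₂ : s₂ = 1 ∨ s₂ = -1)
    (hs₃ : s₃ = 1 ∨ s₃ = -1)
    (h : ∀ χ : DirichletCharacter ℂ n, χ.IsPrimitive → s₁ * χ a + s₂ * χ b + s₃ * χ c = 0) :
    9 ∣ n := by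
  classical
  have hf0 : n ≠ 0 := NeZero.ne n
  have hσ : s₁ * s₂ = 1 ∨ s₁ * s₂ = -1 := by
    rcases hs₁ with rfl | rfl <;> rcases hs₂ with rfl | rfl <;> norm_num
  have hσ2 : (s₁ * s₂) ^ 2 = 1 := by rcases hσ with h1 | h1 <;> rw [h1] <;> norm_num
  have hs₁2 : s₁ ^ 2 = 1 := by rcases hs₁ with h1 | h1 <;> rw [h1] <;> norm_num
  -- Step 1: `χ(b/a)² + (s₁s₂) χ(b/a) + 1 = 0` for every primitive `χ`
  have hquad : ∀ χ : DirichletCharacter ℂ n, χ.IsPrimitive →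
      χ ((b * a⁻¹ : (ZMod n)ˣ) : ZMod n) ^ 2 + s₁ * s₂ * χ ((b * a⁻¹ : (ZMod n)ˣ) : ZMod n) + 1
        = 0 := by
    intro χ hχ
    have ha0 : χ a ≠ 0 := fun h0 ↦ by
      have := DirichletCharacter.unit_norm_eq_one χ a; rw [h0, norm_zero] at this
      exact zero_ne_one this
    have hI : χ a * (χ a)⁻¹ = 1 := mul_inv_cancel₀ ha0
    have hsum : (1 : ℂ) + s₁ * s₂ * χ ((b * a⁻¹ : (ZMod n)ˣ) : ZMod n) +
        s₁ * s₃ * χ ((c * a⁻¹ : (ZMod n)ˣ) : ZMod n) = 0 := by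
      have E : (s₁ * χ a + s₂ * χ b + s₃ * χ c) * (s₁ * (χ a)⁻¹) = 0 := by
        rw [h χ hχ, zero_mul]
      rw [Units.val_mul, map_mul, map_units_inv, Units.val_mul, map_mul, map_units_inv]
      linear_combination E - hs₁2 - s₁ ^ 2 * hI
    have hn1 : ‖s₁ * s₂ * χ ((b * a⁻¹ : (ZMod n)ˣ) : ZMod n)‖ = 1 := by
      rw [norm_mul, norm_mul, DirichletCharacter.unit_norm_eq_one χ (b * a⁻¹)]
      rcases hs₁ with h1 | h1 <;> rcases hs₂ with h2 | h2 <;> rw [h1, h2] <;> norm_num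
    have hn2 : ‖s₁ * s₃ * χ ((c * a⁻¹ : (ZMod n)ˣ) : ZMod n)‖ = 1 := by
      rw [norm_mul, norm_mul, DirichletCharacter.unit_norm_eq_one χ (c * a⁻¹)]
      rcases hs₁ with h1 | h1 <;> rcases hs₃ with h3 | h3 <;> rw [h1, h3] <;> norm_num
    obtain ⟨hA, -⟩ := cube_of_add_three_eq_zero (by norm_num) hn1 hn2 hsum
    simp only [inv_one, mul_one] at hA
    linear_combination hA - (χ ((b * a⁻¹ : (ZMod n)ˣ) : ZMod n)) ^ 2 * hσ2
  -- Step 2: `χ((b/a)³) = s₁ s₂` for every primitive `χ`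
  have hcube : ∀ χ : DirichletCharacter ℂ n, χ.IsPrimitive →
      χ (((b * a⁻¹) ^ 3 : (ZMod n)ˣ) : ZMod n) = s₁ * s₂ := by
    intro χ hχ
    rw [Units.val_pow_eq_pow_val, map_pow]
    have hq := hquad χ hχ
    linear_combination (χ ((b * a⁻¹ : (ZMod n)ˣ) : ZMod n) - s₁ * s₂) * hq +
      χ ((b * a⁻¹ : (ZMod n)ˣ) : ZMod n) * hσ2
  -- Step 3: `(b/a)⁶ = 1`
  have h6 : (b * a⁻¹) ^ 6 = 1 := by
    have h2 := sq_eq_one_of_forall_isPrimitive hval ((b * a⁻¹) ^ 3) hσ hcube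
    apply Units.ext
    have : (((b * a⁻¹) ^ 6 : (ZMod n)ˣ) : ZMod n) = (((b * a⁻¹) ^ 3 : (ZMod n)ˣ) : ZMod n) ^ 2 := by
      rw [← Units.val_pow_eq_pow_val, ← pow_mul]
    rw [this, h2, Units.val_one]
  -- Step 4: `c₀ = (b/a)⁴` has `c₀³ = 1` and `χ(c₀)` is a primitive cube root of unity
  set c₀ : (ZMod n)ˣ := (b * a⁻¹) ^ 4 with hc₀
  have hc₀3 : c₀ ^ 3 = 1 := by
    rw [hc₀, ← pow_mul, show 4 * 3 = 6 * 2 by norm_num, pow_mul, h6, one_pow]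
  have hc₀ne : ∀ χ : DirichletCharacter ℂ n, χ.IsPrimitive → χ (c₀ : ZMod n) ≠ 1 := by
    intro χ hχ h1
    have hval4 : χ (c₀ : ZMod n) = s₁ * s₂ * χ ((b * a⁻¹ : (ZMod n)ˣ) : ZMod n) := by
      rw [hc₀, show (b * a⁻¹) ^ 4 = (b * a⁻¹) ^ 3 * (b * a⁻¹) by rw [pow_succ], Units.val_mul,
        map_mul, hcube χ hχ]
    have hq := hquad χ hχ
    rw [h1] at hval4
    -- `1 = σ x` and `x² + σ x + 1 = 0` give `x² + 2 = 0`... derive `3 = 0`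
    have hx : χ ((b * a⁻¹ : (ZMod n)ˣ) : ZMod n) = s₁ * s₂ := by
      linear_combination (-(s₁ * s₂)) * hval4 - χ ((b * a⁻¹ : (ZMod n)ˣ) : ZMod n) * hσ2
    rw [hx] at hq
    have h3 : (3 : ℂ) = 0 := by linear_combination hq - 2 * hσ2
    norm_num at h3
  clear_value c₀
  -- Step 5: local triviality and the conclusion
  set x := ((c₀ : ZMod n) - 1).val with hx
  have hxlt : x < n := ZMod.val_lt _
  have hloc : ∀ p : ℕ, p.Prime → p ∣ n → p ≠ 3 → p ^ n.factorization p ∣ x :=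
    fun p hp hpf hp3 ↦ ordProj_dvd_val_sub_one_allprim hval c₀ hc₀3 hc₀ne hp hpf hp3
  by_contra h9
  have hfx : n ∣ x := by
    rw [Nat.dvd_iff_prime_pow_dvd_dvd]
    intro p k hp hpk
    rcases Nat.eq_zero_or_pos k with rfl | hk
    · simp
    have hpf : p ∣ n := dvd_trans (dvd_pow_self p hk.ne') hpk
    by_cases hp3 : p = 3
    · subst hp3
      have hk1 : k = 1 := by
        by_contra hk1
        exact h9 (dvd_trans (pow_dvd_pow 3 (show 2 ≤ k by omega)) hpk)
      subst hk1
      rw [pow_one]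
      exact (threePow_dvd_val_sub_one hpf c₀ hc₀3).2
    · have hle : k ≤ n.factorization p := (hp.pow_dvd_iff_le_factorization hf0).mp hpk
      exact dvd_trans (pow_dvd_pow p hle) (hloc p hp hpf hp3)
  have hx0 : x = 0 := Nat.eq_zero_of_dvd_of_lt hfx hxlt
  obtain ⟨χ₀, hχ₀⟩ := exists_isPrimitive (n := n) hval
  apply hc₀ne χ₀ hχ₀
  have : (c₀ : ZMod n) - 1 = 0 := by
    rw [← ZMod.natCast_zmod_val ((c₀ : ZMod n) - 1), ← hx, hx0, Nat.cast_zero]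
  rw [sub_eq_zero.mp this, map_one]

end FermatCharacter

end Literature.AlgebraicGeometry.HodgeTheory
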